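import Mathlib
import HarnessLib
import Summits.Langlands.Langlands.Theses.SexticResolventInduction

/-!
# Birth skeleton (BC3) for crux stmt-Langlands-17260
`Summit.Langlands.Langlands.Theses.SexticResolventInduction.RotationPairDescent` — line `birth`

THE CRUX (route-Langlands-SexticResolventInduction, K2, rank 3, XL): for every irreducible EVEN
icosahedral `ρ : Γ_ℚ → GL₂(ℂ)` and every cuspidal pair `σ, σ′` on `GL₃(𝔸_ℚ)` whose joint unramified
Satake data are, at almost every `v`, the eigenvalues `{u,1,u⁻¹} ⊔ {u²,1,u⁻²}` of
`(Ad ρ ⊕ Ad ρ′)(Frob_v)` (`u = l/m`, `{l, m}` the Frobenius eigenvalues of `ρ`; `{−1,1,−1}` at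
involution classes) — the conclusion of K1 `ResolventInduction` — there is a cuspidal `π` on
`GL₂(𝔸_ℚ)` whose Satake parameters give `charpoly ρ(Frob_v)` at almost every `v`.

Registrar pass (planner-skel-stmt-Langlands-17260-0, 2026-08-17): the route's own two-layer plan
"K2 ⇐ NoRotationChimera → AdjointDescentPin" with the FORESEEN split of the second node at the seam
between the published descent engine and the new sign pin, i.e. THREE named stubs, each a genuine
lemma of the line, stated over tree declarations only (no local vocabulary):

* `stub_noRotationChimera` (step (i), research): one of `σ, σ′` carries EXACTLY the rotation triple
  `{u, 1, u⁻¹}` of `Ad ρ(Frob_v)` at almost every `v` (no `3/3′` chimera mixing the two triples on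
  balanced halves of the `5A/5B` primes). Intended attack: Rankin–Selberg positivity, then rigidity.
* `stub_adjointDescent` (step (ii), engine in print): a cuspidal `τ` on `GL₃/ℚ` with Satake data
  `{u,1,u⁻¹}` a.e. is self-dual with trivial central character (its Satake multisets are
  inverse-closed with product `1`), hence `τ ≅ Ad(π) ⊗ ν`, `ν² = 1` (Ramakrishnan 2014 Thm. A = tree
  item `IrreducibilityBySelfDuality.SelfdualGL3AdjointLift`, stmt-Langlands-13621), and `ν = 1` a.e. by
  comparing products (`ν(ϖ_v)³ = ν(ϖ_v) = 1`); so some cuspidal `π` on `GL₂/ℚ` has Satake ratios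
  `{a/b, 1, b/a} = {u, 1, u⁻¹}` a.e. — "`Ad π` matches `Ad ρ`", the PROJECTIVE matching.
* `stub_signPin` (step (iii), research, HARDEST): from a cuspidal `π` on `GL₂/ℚ` projectively matching
  `ρ` a.e. to a cuspidal `π′` matching `ρ` itself a.e. (the residual ambiguity
  `Satake(π)_v = t_v · eig ρ(Frob_v)` has `t_v² = ω_π(ϖ_v)/det ρ(Frob_v)` a Hecke character; the sign
  of `t_v` is the pin; for ODD `ρ` this is Deligne–Serre, here it is the crux within the crux).

HONEST CENSUS of what is known against the stubs (read before working them): the idea-node barrier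
note attached to this item (evidence `BarrierNote-balanced-chimera-blindness.md`, planner g18,
2026-08-17) argues that balanced `5A/5B` swaps preserve every `A₅` class-function Dirichlet mean and
free signs kill every genuine `2.A₅` mean, so NO pole-order / Rankin–Selberg / `Sym^{≤4}` identity
internal to `π, π′, σ, σ′` can prove `stub_noRotationChimera` or `stub_signPin`; given K1 + (i) + (ii)
the pin is equivalent to the route target stmt-Langlands-2903 (fibres are single twist classes,
Ramakrishnan's `SL(2)` multiplicity one). A line on these two stubs must therefore import an
EXTERNAL input (a (B)-reference form, or the degree-12 alternative layer of K1 in the route header);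
`stub_adjointDescent` is closable today modulo the tree item stmt-Langlands-13621 (+ uniqueness of
Satake parameters `hasSatakeParamAt_unique_holds`, the trivial Hecke character on `GL₁`, multiset
algebra). Route-review refuter (REVIEW-SexticResolventInduction.md): K2 ⟸ Target (σ, σ′ unused), so
no stub here is refutable short of `¬ Langlands (B)` at an even icosahedral `ρ`.

Disproof used: none — no `Cruxes/RotationPairDescent/Disproof.lean` exists at registration
(`ledger crux ls stmt-Langlands-17260`: only `Lines/birth.lean`); negatives index
(`ledger negatives --problem Langlands`, 4 entries: SplitPrimeInduction ×2, OrdinaryPrimeTransport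
`n = 0`, K3KugaSatakeDescent) — none concerns rank-2/3 Satake matching over `ℚ`; the `n = 0`
degeneracy (stmt-Langlands-17212) cannot occur here (ranks are the literals `2`, `3`).

Composition `RotationPairDescent_of : (i) → (ii) → (iii) → crux` is three lines of logic
(kernel-checked, no `sorry` outside the three `stub_*`); the conclusion is the route decl BY NAME.
Supersedes the pre-open evidence file `RotationPairDescent_birth.lean` (operator, 2026-08-17T01:37Z),
which re-declared the crux locally (it predates the route file) and so could not be registered.
-/

set_option linter.dupNamespace false

noncomputable section

namespace Summit.Langlands.Langlands.Cruxes.RotationPairDescent.Birth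

/-! ## 1. The open stubs (registered obligations; `sorry` lives only here) -/

/-- **STUB (i) — no rotation chimera.** For an irreducible even icosahedral `ρ : Γ_ℚ → GL₂(ℂ)` and a
cuspidal pair `σ, σ′` on `GL₃(𝔸_ℚ)` with the joint Satake data of `ResolventInduction`
(`Satake(σ)_v ⊔ Satake(σ′)_v = {u,1,u⁻¹} ⊔ {u²,1,u⁻²}` a.e.), one of the two constituents carries,
at almost every place, EXACTLY the rotation triple `{u, 1, u⁻¹}` (`u = l/m`). Intended attack:
Rankin–Selberg positivity of `L(s, σ × σ̃)`, `L(s, σ × σ′~)` forces the `5A/5B` swaps to be balanced,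
then a rigidity input; the item's barrier note says internal identities alone do not suffice.
[cite: JacquetShalikaAJM1981II, Thm. 4.8 and §3] -/
theorem stub_noRotationChimera :
    ∀ ρ : Literature.NumberTheory.GaloisRepresentations.FramedGaloisRep ℚ ℂ 2, ρ.toGaloisRep.IsIrreducible → Nonempty ((Matrix.ProjGenLinGroup.mk.comp ρ.toMonoidHom).range ≃* alternatingGroup (Fin 5)) → (∀ (φ : ℚ →+* ℝ) (c : Field.absoluteGaloisGroup ℚ), Literature.NumberTheory.GaloisRepresentations.IsComplexConjugation φ c → Matrix.GeneralLinearGroup.det (ρ c) = 1) → ∀ (hcpt3 : Literature.NumberTheory.Automorphic.isCompact_glFiniteIntegralLevel 3 ℚ) (σ σ' : Literature.NumberTheory.Automorphic.CuspidalAutomorphicRepData 3 ℚ hcpt3), (∀ᶠ v : IsDedekindDomain.HeightOneSpectrum (NumberField.RingOfIntegers ℚ) in Filter.cofinite, ∃ (α β : Multiset ℂ) (l m : ℂ), σ.1.HasSatakeParamAt v α ∧ σ'.1.HasSatakeParamAt v β ∧ ρ.IsUnramifiedAt v ∧ ρ.HasFrobCharpolyAt v (Literature.NumberTheory.Automorphic.satakePolynomial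 {l, m}) ∧ α + β = {l / m, 1, m / l} + (if l + m = 0 then {-1, 1, -1} else {(l / m) ^ 2, 1, (m / l) ^ 2})) → ∃ τ : Literature.NumberTheory.Automorphic.CuspidalAutomorphicRepData 3 ℚ hcpt3, (τ = σ ∨ τ = σ') ∧ (∀ᶠ v : IsDedekindDomain.HeightOneSpectrum (NumberField.RingOfIntegers ℚ) in Filter.cofinite, ∃ (γ : Multiset ℂ) (l m : ℂ), τ.1.HasSatakeParamAt v γ ∧ ρ.IsUnramifiedAt v ∧ ρ.HasFrobCharpolyAt v (Literature.NumberTheory.Automorphic.satakePolynomial {l, m}) ∧ γ = {l / m, 1, m / l}) := by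
  sorry

/-- **STUB (ii) — adjoint descent to the projective matching** (the engine in print). A cuspidal
`τ` on `GL₃(𝔸_ℚ)` whose Satake parameter at almost every `v` is the rotation triple `{u, 1, u⁻¹}` of
`Ad ρ(Frob_v)` comes from `GL₂`: there is a cuspidal `π` on `GL₂(𝔸_ℚ)` with Satake parameters
`{a, b}` and `{a/b, 1, b/a} = {u, 1, u⁻¹}` at almost every `v`. Paper proof: the Satake multisets of
`τ` are inverse-closed with product `1`, so `τ` is self-dual with trivial central character (strong
multiplicity one); Ramakrishnan's Theorem A gives `τ ≅ Ad(π) ⊗ ν` with `ν² = 1` (tree item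
`IrreducibilityBySelfDuality.SelfdualGL3AdjointLift`, stmt-Langlands-13621, with `η = 1`, `d² = 1`);
comparing products of Satake parameters, `ν(ϖ_v) = ν(ϖ_v)³ = 1` a.e., so `Satake(τ)_v =
{a/b, 1, b/a}`. [cite: Ramakrishnan2014, Thm. A] [cite: GelbartJacquet1978, Thm. 9.3] -/
theorem stub_adjointDescent :
    ∀ ρ : Literature.NumberTheory.GaloisRepresentations.FramedGaloisRep ℚ ℂ 2, ρ.toGaloisRep.IsIrreducible → Nonempty ((Matrix.ProjGenLinGroup.mk.comp ρ.toMonoidHom).range ≃* alternatingGroup (Fin 5)) → (∀ (φ : ℚ →+* ℝ) (c : Field.absoluteGaloisGroup ℚ), Literature.NumberTheory.GaloisRepresentations.IsComplexConjugation φ c → Matrix.GeneralLinearGroup.det (ρ c) = 1) → ∀ (hcpt3 : Literature.NumberTheory.Automorphic.isCompact_glFiniteIntegralLevel 3 ℚ) (τ : Literature.NumberTheory.Automorphic.CuspidalAutomorphicRepData 3 ℚ hcpt3), (∀ᶠ v : IsDedekindDomain.HeightOneSpectrum (NumberField.RingOfIntegers ℚ) in Filter.cofinite, ∃ (γ : Multiset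 ℂ) (l m : ℂ), τ.1.HasSatakeParamAt v γ ∧ ρ.IsUnramifiedAt v ∧ ρ.HasFrobCharpolyAt v (Literature.NumberTheory.Automorphic.satakePolynomial {l, m}) ∧ γ = {l / m, 1, m / l}) → ∃ (hcpt2 : Literature.NumberTheory.Automorphic.isCompact_glFiniteIntegralLevel 2 ℚ) (π : Literature.NumberTheory.Automorphic.CuspidalAutomorphicRepData 2 ℚ hcpt2), (∀ᶠ v : IsDedekindDomain.HeightOneSpectrum (NumberField.RingOfIntegers ℚ) in Filter.cofinite, ∃ (a b l m : ℂ), π.1.HasSatakeParamAt v {a, b} ∧ ρ.IsUnramifiedAt v ∧ ρ.HasFrobCharpolyAt v (Literature.NumberTheory.Automorphic.satakePolynomial {l, m}) ∧ ({a / b, 1, b / a} : Multiset ℂ) = {l / m, 1, m / l}) := by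
  sorry

/-- **STUB (iii) — the sign pin** (HARDEST; new). For an irreducible even icosahedral `ρ` and a
cuspidal `π` on `GL₂(𝔸_ℚ)` projectively matching `ρ` (`{a/b, 1, b/a} = {l/m, 1, m/l}` a.e.), some
cuspidal `π′` on `GL₂(𝔸_ℚ)` matches `ρ` itself at almost every place. Heuristic: `Satake(π)_v =
t_v · {l, m}` with `t_v² = ω_π(ϖ_v) / det ρ(Frob_v)` the value of a Hecke character; IF the signs
make `v ↦ t_v` itself a Hecke character `χ` (a.e.), `π′ := π ⊗ χ⁻¹` works. For odd `ρ` the pin is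
Deligne–Serre (weight one); for even `ρ` no engine is known, and the item's barrier note shows no
identity among `L`-functions of `π`, `Sym^k π` (`k ≤ 4`) and their Rankin–Selberg products detects the
signs — an external (B)-input is expected to be necessary. Implied by the route target (ignore `π`).
[cite: Ramakrishnan2000, Thm. A] [cite: Booker2003, Thm. 1] -/
theorem stub_signPin :
    ∀ ρ : Literature.NumberTheory.GaloisRepresentations.FramedGaloisRep ℚ ℂ 2, ρ.toGaloisRep.IsIrreducible → Nonempty ((Matrix.ProjGenLinGroup.mk.comp ρ.toMonoidHom).range ≃* alternatingGroup (Fin 5)) → (∀ (φ : ℚ →+* ℝ) (c : Field.absoluteGaloisGroup ℚ), Literature.NumberTheory.GaloisRepresentations.IsComplexConjugation φ c → Matrix.GeneralLinearGroup.det (ρ c) = 1) → ∀ (hcpt2 : Literature.NumberTheory.Automorphic.isCompact_glFiniteIntegralLevel 2 ℚ) (π : Literature.NumberTheory.Automorphic.CuspidalAutomorphicRepData 2 ℚ hcpt2), (∀ᶠ v : IsDedekindDomain.HeightOneSpectrum (NumberField.RingOfIntegers ℚ) in Filter.cofinite, ∃ (a b l m : ℂ), π.1.HasSatakeParamAt v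 {a, b} ∧ ρ.IsUnramifiedAt v ∧ ρ.HasFrobCharpolyAt v (Literature.NumberTheory.Automorphic.satakePolynomial {l, m}) ∧ ({a / b, 1, b / a} : Multiset ℂ) = {l / m, 1, m / l}) → ∃ (hcpt : Literature.NumberTheory.Automorphic.isCompact_glFiniteIntegralLevel 2 ℚ) (π' : Literature.NumberTheory.Automorphic.CuspidalAutomorphicRepData 2 ℚ hcpt), (∀ᶠ v : IsDedekindDomain.HeightOneSpectrum (NumberField.RingOfIntegers ℚ) in Filter.cofinite, ∃ α : Multiset ℂ, π'.1.HasSatakeParamAt v α ∧ ρ.IsUnramifiedAt v ∧ ρ.HasFrobCharpolyAt v (Literature.NumberTheory.Automorphic.satakePolynomial α)) := by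
  sorry

/-! ## 2. The stub statements as named propositions (the composition's hypotheses, by name) -/

namespace _Goal

/-- The statement of `stub_noRotationChimera`, as a named `Prop` (literally its type). [folklore] -/
def stub_noRotationChimera : Prop :=
  type_of% @Summit.Langlands.Langlands.Cruxes.RotationPairDescent.Birth.stub_noRotationChimera

/-- The statement of `stub_adjointDescent`, as a named `Prop` (literally its type). [folklore] -/
def stub_adjointDescent : Prop :=
  type_of% @Summit.Langlands.Langlands.Cruxes.RotationPairDescent.Birth.stub_adjointDescent

/-- The statement of `stub_signPin`, as a named `Prop` (literally its type). [folklore] -/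
def stub_signPin : Prop :=
  type_of% @Summit.Langlands.Langlands.Cruxes.RotationPairDescent.Birth.stub_signPin

end _Goal

/-! ## 3. The composition (kernel-checked, no `sorry`): (i) → (ii) → (iii) → crux, by name -/

/-- **`RotationPairDescent` from the three stubs.** Fix an irreducible even icosahedral `ρ` and a
cuspidal pair `σ, σ′` on `GL₃/ℚ` with the joint Satake data; (i) picks the constituent `τ` carrying
the rotation triple a.e.; (ii) descends it to a cuspidal `π` on `GL₂/ℚ` projectively matching `ρ`;
(iii) pins the sign: some cuspidal `π′` matches `ρ` a.e. — the conclusion of the crux, whose decl is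
the result type BY NAME. [folklore] -/
theorem RotationPairDescent_of (h1 : _Goal.stub_noRotationChimera) (h2 : _Goal.stub_adjointDescent)
    (h3 : _Goal.stub_signPin) :
    Summit.Langlands.Langlands.Theses.SexticResolventInduction.RotationPairDescent := by
  unfold _Goal.stub_noRotationChimera at h1
  unfold _Goal.stub_adjointDescent at h2
  unfold _Goal.stub_signPin at h3
  intro ρ hirr hico heven hcpt3 σ σ' hae
  obtain ⟨τ, -, hτ⟩ := h1 ρ hirr hico heven hcpt3 σ σ' hae
  obtain ⟨hcpt2, π, hπ⟩ := h2 ρ hirr hico heven hcpt3 τ hτ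
  exact h3 ρ hirr hico heven hcpt2 π hπ

/-- By-name sanity check (an `example`, not a declaration of the file): the open stubs feed the
composition as they stand. -/
example : Summit.Langlands.Langlands.Theses.SexticResolventInduction.RotationPairDescent :=
  RotationPairDescent_of stub_noRotationChimera stub_adjointDescent stub_signPin

end Summit.Langlands.Langlands.Cruxes.RotationPairDescent.Birth

end
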